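import Summits.QuantumFields.YangMills.Theorems.CovariantDischargeLatticeFormsDeg23
import Summits.QuantumFields.YangMills.Theorems.CovariantDischargeCutoffCommutator
import HarnessLib

/-!
# Line «sandwich_discharge» on crux `HistoryTailL` (stmt-QuantumFields-19936), stub `stub_sandwichSweepGapCapped` (S′), brick B5 on `ℤ^d` —
# (Z-e) FILE 1 «THE TRUNCATED POTENTIAL: ITS CURL POINTWISE, THE EXACT PAIRING IDENTITY, AND THE TWO ERROR ROWS»

Cell `ym3-torus` (YM ladder rung R3 = continuum SU(2) Yang–Mills on the three-torus — a RUNG, NOT the Clay problem: not d = 4, not infinite volume,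
not a mass gap); width seat `ym3-torus-px8` gen 7; `--supports stmt-QuantumFields-19936` (helper).  THEOREMS ONLY (0 `def`, default heartbeats); generic `d`;
every operator is a FREE FUNCTION SYMBOL pinned by a pointwise defining hypothesis in the letters of ✓(Z-a) `CovariantDischargeLatticeFormsDeg23` (seat px6 g8)
and ✓(Z-b) `CovariantDischargeCutoffCommutator`, so the knit instantiates with closed forms and discharges by `fun _ .. => rfl`.

THE OBJECTS (px8 g6 ARCH-S′ §3 relocated to `ℤ³` by w8 g8 LOCATE-B5-Z3-COMMUTATOR (P1)–(P3)).  `ω` a real 2-form supported in `box p ℓ`; `β` ANY 2-form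
with `−Δβ = ω` componentwise (the knit takes `β := G₀ ∗ ω`, FILE 2); `a := δ₂β`, `γ := d₂β` (alternating), `χ` a cutoff `= 1` on `box p R ⊇ box p ℓ`, `= 0`
off `box p S`; `a_R := χ·a`, `d₁a_R` its curl.  WHAT IS PROVED:
* §1 ★★`curl_truncated_eq` (POINTWISE, all of `ℤ^d`): `d₁a_R = ω − δ₃(χ̂γ) − C₂ + E₁` where `χ̂γ := χ·γ`, `C₂(x,μ,ν) = Σ_κ (χ x − χ(x−e_κ))·γ(x−e_κ,κ,μ,ν)`
  (the degree-2→3 commutator of (Z-b)) and `E₁(x,μ,ν) = (χ(x+e_μ) − χ x)·a(x+e_μ,ν) − (χ(x+e_ν) − χ x)·a(x+e_ν,μ)` (the degree-1→2 commutator) — from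
  (Z-a) `curl_deltaTwo_eq` (`d₁δ₂β = −Δβ − δ₃d₂β`) and (Z-b) `curl_mul_eq_of_letter` ∕ `mul_deltaThree_sub_deltaThree_mul`; `χ·ω = ω` because `χ = 1` on
  the support of `ω`.
* §2 ★★`sum_curl_truncated_mul_eq` (THE EXACT PAIRING IDENTITY on the box `Q := box p R′`, `S + 2 ≤ R′`, against ANY 2-form `F`):
  `Σ_Q Σ_{μν} d₁a_R·F = Σ_Q Σ_{μν} ω·F − Σ_Q Σ_{κμν} (χ̂γ)_{κμν}·∇_κF_{μν} − Σ_Q Σ_{μν} C₂·F + Σ_Q Σ_{μν} E₁·F` — the bulk term moved onto `F` by (Z-a)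
  `sum_deltaThree_mul_of_support` (finite summation by parts; `χ̂γ` vanishes off `box p (S+1) ⊆ box p (R′−1)`).
* §3 ★★★`abs_sum_curl_truncated_mul_sub_le` (THE TWO ERROR ROWS): if `|F| ≤ θ` on `Q`, `χ` is `ρ`-Lipschitz in both directions with `0 ≤ χ ≤ 1`, `β` is
  antisymmetric and `|d₂F| ≤ η` on `box p S` (alternating `d₂`), then
  `|Σ_Q Σ d₁a_R·F − Σ_Q Σ ω·F| ≤ θ·ρ·SHELL + (η∕3)·BULK`,  `SHELL := Σ_{box p (S+1) ∖ box p (R−1)} Σ_{μν} (|a(y+e_μ,ν)| + |a(y+e_ν,μ)| + Σ_κ|γ(y−e_κ,κ,μ,ν)|)`,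
  `BULK := Σ_{box p S} Σ_{κμν} |γ(y,κ,μ,ν)|` — the commutators live on the shell ((Z-b) plateau∕outside rows), the bulk is `⅓⟨χ̂γ, d₂F⟩` by (Z-a)
  `sum_mul_dTwo_eq_three_mul` (total antisymmetry of `γ = d₂β` from (Z-a) `dTwo_swap_left∕right`).  For a `d₂`-CLOSED `F` (`η = 0`) only the shell remains.
* §4 ℓ² PREP `(d₁a_R)² ≤ 2·(ω − δ₃γ)² + 2·E₁²`, `E₁² ≤ 2ρ²(a(x+e_μ,ν)² + a(x+e_ν,μ)²)`, summed; §5 ℓ¹∕sup PREP `|a_R| ≤ |a|`, `Σ_B|a_R| ≤ Σ_{box p S}|a|`.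
FILE 2 (d = 3) discharges the Poisson hypothesis from `β := G₀ ∗ ω` (lit ✓`latticeLaplacianZd_half_latticeGreen`) and prices SHELL ∕ BULK ∕ the ℓ² row by
✓p713769 (Z-c), (Z-c′), (Z-d).  Restates no stub.  HONEST SCOPE: finite-sum identities and the triangle inequality; NOTHING here proves B5, the capped stub,
`HistoryTailL`, or any summit statement; YM₃ on T³ is rung R3, not Clay. [folklore]
-/

noncomputable section

open scoped BigOperators
open Finset

namespace Summit.QuantumFields.YangMills.Theorems.CovariantDischargeTruncatedPotentialPairing

open Literature.MathematicalPhysics.QuantumFieldTheory.Balaban1983to89.B4Eq19LatticeOperators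
open Summit.QuantumFields.YangMills.Theorems.CovariantDischargeLatticeFormsDeg23 (curl_deltaTwo_eq sum_deltaThree_mul_of_support
  sum_mul_dTwo_eq_three_mul dTwo_swap_left dTwo_swap_right)
open Summit.QuantumFields.YangMills.Theorems.CovariantDischargeCutoffCommutator (curl_mul_eq_of_letter mul_deltaThree_sub_deltaThree_mul
  abs_curl_comm_le abs_deltaThree_comm_le curl_comm_eq_zero_of_mem_box curl_comm_eq_zero_of_not_mem_box deltaThree_comm_eq_zero_of_mem_box
  deltaThree_comm_eq_zero_of_not_mem_box abs_sum_mul_le_of_abs_le sum_abs_le_sum_abs_shell sum_abs_le_mul_sum_of_le)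

variable {d : ℕ}

/-! ## §1 The curl of the truncated potential, pointwise -/

/-- The cutoff is the identity on the charge: `χ(x)·ω(x) = ω(x)` when `χ = 1` on `box p R`, `ω = 0` off `box p ℓ`, `ℓ ≤ R`. [folklore] -/
theorem cutoff_mul_charge_eq {ω : Zd d → Fin d → Fin d → ℝ} {χ : Zd d → ℝ} {p : Zd d} {ℓ R : ℤ}
    (hω0 : ∀ x, x ∉ box p ℓ → ∀ μ ν, ω x μ ν = 0) (hℓR : ℓ ≤ R) (hχ1 : ∀ x ∈ box p R, χ x = 1) (x : Zd d) (μ ν : Fin d) :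
    χ x * ω x μ ν = ω x μ ν := by
  by_cases hx : x ∈ box p R
  · rw [hχ1 x hx, one_mul]
  · have hx' : x ∉ box p ℓ := fun h => hx (box_mono p hℓR h)
    rw [hω0 x hx' μ ν, mul_zero]

/-- ★★ **THE CURL OF THE TRUNCATED POTENTIAL, POINTWISE.**  With `−Δβ = ω`, `a = δ₂β`, `γ = d₂β`, `a_R = χ·a` (`χ = 1` on `box p R ⊇ supp ω`):
`d₁a_R(x,μ,ν) = ω(x,μ,ν) − δ₃(χ̂γ)(x,μ,ν) − C₂(x,μ,ν) + E₁(x,μ,ν)` on all of `ℤ^d`. [folklore] -/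
theorem curl_truncated_eq (ω β : Zd d → Fin d → Fin d → ℝ) (a : Zd d → Fin d → ℝ) (γ : Zd d → Fin d → Fin d → Fin d → ℝ) (χ : Zd d → ℝ)
    (aR : Zd d → Fin d → ℝ) (daR : Zd d → Fin d → Fin d → ℝ) (p : Zd d) (ℓ R : ℤ)
    (hω0 : ∀ x, x ∉ box p ℓ → ∀ μ ν, ω x μ ν = 0) (hℓR : ℓ ≤ R)
    (hΔ : ∀ x μ ν, ω x μ ν = ∑ κ, (2 * β x μ ν - β (x + unitVec κ) μ ν - β (x - unitVec κ) μ ν))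
    (ha : ∀ x ν, a x ν = ∑ μ, (β (x - unitVec μ) μ ν - β x μ ν))
    (hγ : ∀ x κ μ ν, γ x κ μ ν = (β (x + unitVec κ) μ ν - β x μ ν) - (β (x + unitVec μ) κ ν - β x κ ν) + (β (x + unitVec ν) κ μ - β x κ μ))
    (hχ1 : ∀ x ∈ box p R, χ x = 1) (haR : ∀ x ν, aR x ν = χ x * a x ν)
    (hdaR : ∀ x μ ν, daR x μ ν = (aR (x + unitVec μ) ν - aR x ν) - (aR (x + unitVec ν) μ - aR x μ))
    (x : Zd d) (μ ν : Fin d) :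
    daR x μ ν = ω x μ ν
      - ∑ κ, (χ (x - unitVec κ) * γ (x - unitVec κ) κ μ ν - χ x * γ x κ μ ν)
      - ∑ κ, (χ x - χ (x - unitVec κ)) * γ (x - unitVec κ) κ μ ν
      + ((χ (x + unitVec μ) - χ x) * a (x + unitVec μ) ν - (χ (x + unitVec ν) - χ x) * a (x + unitVec ν) μ) := by
  -- product rule with commutator
  have h1 := curl_mul_eq_of_letter χ a (fun y μ' ν' => (a (y + unitVec μ') ν' - a y ν') - (a (y + unitVec ν') μ' - a y μ'))
    (fun _ _ _ => rfl) x μ ν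
  -- Hodge: `d₁δ₂β = ω − δ₃d₂β`
  have h2 := curl_deltaTwo_eq β a γ ω ha hγ x μ ν (hΔ x μ ν)
  -- the cutoff through `δ₃`
  have h3 := mul_deltaThree_sub_deltaThree_mul χ γ x μ ν
  have h4 := cutoff_mul_charge_eq hω0 hℓR hχ1 x μ ν
  rw [hdaR, haR, haR, haR, haR, h1, h2, mul_sub, h4]
  linarith [h3]

/-! ## §2 The exact pairing identity on a box -/

/-- `χ̂γ` vanishes off `box p S` when `χ` does. [folklore] -/
theorem cutoff_mul_eq_zero_off {χ : Zd d → ℝ} {p : Zd d} {S : ℤ} (hχ0 : ∀ x, x ∉ box p S → χ x = 0)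
    (γ : Zd d → Fin d → Fin d → Fin d → ℝ) (y : Zd d) (hy : y ∉ box p S) (κ μ ν : Fin d) : χ y * γ y κ μ ν = 0 := by
  rw [hχ0 y hy, zero_mul]

/-- ★★ **THE EXACT PAIRING IDENTITY.**  On `Q = box p R′` with `S + 2 ≤ R′` (`χ = 0` off `box p S`), for EVERY 2-form `F`:
`Σ_Q Σ_{μν} d₁a_R·F = Σ_Q Σ_{μν} ω·F − Σ_Q Σ_{κμν} (χγ)_{κμν}·(F(y+e_κ)_{μν} − F(y)_{μν}) − Σ_Q Σ_{μν} C₂·F + Σ_Q Σ_{μν} E₁·F`. [folklore] -/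
theorem sum_curl_truncated_mul_eq (ω β : Zd d → Fin d → Fin d → ℝ) (a : Zd d → Fin d → ℝ) (γ : Zd d → Fin d → Fin d → Fin d → ℝ)
    (χ : Zd d → ℝ) (aR : Zd d → Fin d → ℝ) (daR : Zd d → Fin d → Fin d → ℝ) (p : Zd d) (ℓ R S R' : ℤ)
    (hω0 : ∀ x, x ∉ box p ℓ → ∀ μ ν, ω x μ ν = 0) (hℓR : ℓ ≤ R) (hSR' : S + 2 ≤ R')
    (hΔ : ∀ x μ ν, ω x μ ν = ∑ κ, (2 * β x μ ν - β (x + unitVec κ) μ ν - β (x - unitVec κ) μ ν))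
    (ha : ∀ x ν, a x ν = ∑ μ, (β (x - unitVec μ) μ ν - β x μ ν))
    (hγ : ∀ x κ μ ν, γ x κ μ ν = (β (x + unitVec κ) μ ν - β x μ ν) - (β (x + unitVec μ) κ ν - β x κ ν) + (β (x + unitVec ν) κ μ - β x κ μ))
    (hχ1 : ∀ x ∈ box p R, χ x = 1) (hχ0 : ∀ x, x ∉ box p S → χ x = 0) (haR : ∀ x ν, aR x ν = χ x * a x ν)
    (hdaR : ∀ x μ ν, daR x μ ν = (aR (x + unitVec μ) ν - aR x ν) - (aR (x + unitVec ν) μ - aR x μ))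
    (F : Zd d → Fin d → Fin d → ℝ) :
    ∑ y ∈ box p R', ∑ μ, ∑ ν, daR y μ ν * F y μ ν
      = ∑ y ∈ box p R', ∑ μ, ∑ ν, ω y μ ν * F y μ ν
        - ∑ y ∈ box p R', ∑ κ, ∑ μ, ∑ ν, (χ y * γ y κ μ ν) * (F (y + unitVec κ) μ ν - F y μ ν)
        - ∑ y ∈ box p R', ∑ μ, ∑ ν, (∑ κ, (χ y - χ (y - unitVec κ)) * γ (y - unitVec κ) κ μ ν) * F y μ ν
        + ∑ y ∈ box p R', ∑ μ, ∑ ν,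
            ((χ (y + unitVec μ) - χ y) * a (y + unitVec μ) ν - (χ (y + unitVec ν) - χ y) * a (y + unitVec ν) μ) * F y μ ν := by
  -- the bulk term by finite summation by parts ((Z-a)), with `ψ := χ̂γ` vanishing off `box p (R' − 1) ⊇ box p S`
  have hψ : ∀ y, y ∉ box p (R' - 1) → ∀ κ μ ν, (fun y κ μ ν => χ y * γ y κ μ ν) y κ μ ν = 0 := by
    intro y hy κ μ ν
    exact cutoff_mul_eq_zero_off hχ0 γ y (fun h => hy (box_mono p (by linarith) h)) κ μ ν
  have hbulk := sum_deltaThree_mul_of_support (fun y κ μ ν => χ y * γ y κ μ ν) F p R' hψ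
  rw [← hbulk]
  -- pointwise identity, summed
  have hpt : ∀ y μ ν, daR y μ ν * F y μ ν = ω y μ ν * F y μ ν
      - (∑ κ, (χ (y - unitVec κ) * γ (y - unitVec κ) κ μ ν - χ y * γ y κ μ ν)) * F y μ ν
      - (∑ κ, (χ y - χ (y - unitVec κ)) * γ (y - unitVec κ) κ μ ν) * F y μ ν
      + ((χ (y + unitVec μ) - χ y) * a (y + unitVec μ) ν - (χ (y + unitVec ν) - χ y) * a (y + unitVec ν) μ) * F y μ ν := by
    intro y μ ν
    rw [curl_truncated_eq ω β a γ χ aR daR p ℓ R hω0 hℓR hΔ ha hγ hχ1 haR hdaR y μ ν]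
    ring
  simp only [hpt, Finset.sum_add_distrib, Finset.sum_sub_distrib]

/-! ## §3 The two error rows -/

/-- `γ = d₂β` is totally antisymmetric for antisymmetric `β`; hence so is `χ̂γ`. [folklore] -/
theorem cutoff_mul_dTwo_anti (β : Zd d → Fin d → Fin d → ℝ) (γ : Zd d → Fin d → Fin d → Fin d → ℝ) (χ : Zd d → ℝ)
    (hγ : ∀ x κ μ ν, γ x κ μ ν = (β (x + unitVec κ) μ ν - β x μ ν) - (β (x + unitVec μ) κ ν - β x κ ν) + (β (x + unitVec ν) κ μ - β x κ μ))
    (hβanti : ∀ x μ ν, β x ν μ = -β x μ ν) :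
    (∀ x κ μ ν, (fun y κ μ ν => χ y * γ y κ μ ν) x μ κ ν = -(fun y κ μ ν => χ y * γ y κ μ ν) x κ μ ν) ∧
      (∀ x κ μ ν, (fun y κ μ ν => χ y * γ y κ μ ν) x κ ν μ = -(fun y κ μ ν => χ y * γ y κ μ ν) x κ μ ν) := by
  refine ⟨fun x κ μ ν => ?_, fun x κ μ ν => ?_⟩
  · simp only [dTwo_swap_left β γ hγ hβanti x κ μ ν, mul_neg]
  · simp only [dTwo_swap_right β γ hγ hβanti x κ μ ν, mul_neg]

/-- **THE BULK ROW**: for antisymmetric `β`, `0 ≤ χ ≤ 1` vanishing off `box p S ⊆ Q = box p R′`, and `|d₂F| ≤ η` on `box p S` (alternating `d₂`),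
`|Σ_Q Σ_{κμν} (χγ)·∇_κF| ≤ (η∕3)·Σ_{box p S} Σ_{κμν}|γ|`. [folklore] -/
theorem abs_bulk_le (β : Zd d → Fin d → Fin d → ℝ) (γ : Zd d → Fin d → Fin d → Fin d → ℝ) (χ : Zd d → ℝ) (p : Zd d) (S R' : ℤ)
    (hγ : ∀ x κ μ ν, γ x κ μ ν = (β (x + unitVec κ) μ ν - β x μ ν) - (β (x + unitVec μ) κ ν - β x κ ν) + (β (x + unitVec ν) κ μ - β x κ μ))
    (hβanti : ∀ x μ ν, β x ν μ = -β x μ ν) (hχ01 : ∀ x, 0 ≤ χ x ∧ χ x ≤ 1) (hχ0 : ∀ x, x ∉ box p S → χ x = 0) (hSR' : S ≤ R')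
    (F : Zd d → Fin d → Fin d → ℝ) (dF : Zd d → Fin d → Fin d → Fin d → ℝ)
    (hdF : ∀ x κ μ ν, dF x κ μ ν = (F (x + unitVec κ) μ ν - F x μ ν) - (F (x + unitVec μ) κ ν - F x κ ν) + (F (x + unitVec ν) κ μ - F x κ μ))
    {η : ℝ} (hdFle : ∀ y ∈ box p S, ∀ κ μ ν, |dF y κ μ ν| ≤ η) :
    |∑ y ∈ box p R', ∑ κ, ∑ μ, ∑ ν, (χ y * γ y κ μ ν) * (F (y + unitVec κ) μ ν - F y μ ν)|
      ≤ η / 3 * ∑ y ∈ box p S, ∑ κ, ∑ μ, ∑ ν, |γ y κ μ ν| := by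
  obtain ⟨hanti₁, hanti₂⟩ := cutoff_mul_dTwo_anti β γ χ hγ hβanti
  -- per site: `Σ ψ·∇F = ⅓ Σ ψ·d₂F`
  have hsite : ∀ y, ∑ κ, ∑ μ, ∑ ν, (χ y * γ y κ μ ν) * (F (y + unitVec κ) μ ν - F y μ ν)
      = (1 / 3) * ∑ κ, ∑ μ, ∑ ν, (χ y * γ y κ μ ν) * dF y κ μ ν := by
    intro y
    have h3 := sum_mul_dTwo_eq_three_mul (fun y κ μ ν => χ y * γ y κ μ ν) F dF hdF hanti₁ hanti₂ y
    rw [h3]; ring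
  simp only [hsite, ← Finset.mul_sum]
  rw [abs_mul, abs_of_pos (by norm_num : (0 : ℝ) < 1 / 3), show η / 3 = 1 / 3 * η by ring, mul_assoc]
  refine mul_le_mul_of_nonneg_left ?_ (by norm_num)
  -- restrict to `box p S` (terms vanish outside), then bound termwise
  have hvan : ∀ y ∈ box p R', y ∉ box p S → ∑ κ, ∑ μ, ∑ ν, (χ y * γ y κ μ ν) * dF y κ μ ν = 0 := by
    intro y _ hy
    simp only [hχ0 y hy, zero_mul, Finset.sum_const_zero]
  have hsub : box p S ⊆ box p R' := box_mono p hSR'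
  rw [← Finset.sum_subset hsub hvan]
  refine (Finset.abs_sum_le_sum_abs _ _).trans ?_
  rw [Finset.mul_sum]
  refine Finset.sum_le_sum fun y hy => ?_
  refine (Finset.abs_sum_le_sum_abs _ _).trans ?_
  rw [Finset.mul_sum]
  refine Finset.sum_le_sum fun κ _ => ?_
  refine (Finset.abs_sum_le_sum_abs _ _).trans ?_
  rw [Finset.mul_sum]
  refine Finset.sum_le_sum fun μ _ => ?_
  refine (Finset.abs_sum_le_sum_abs _ _).trans ?_
  rw [Finset.mul_sum]
  refine Finset.sum_le_sum fun ν _ => ?_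
  rw [abs_mul, abs_mul]
  have hχy : |χ y| ≤ 1 := abs_le.2 ⟨by linarith [(hχ01 y).1], (hχ01 y).2⟩
  calc |χ y| * |γ y κ μ ν| * |dF y κ μ ν| ≤ 1 * |γ y κ μ ν| * η := by
        refine mul_le_mul (mul_le_mul_of_nonneg_right hχy (abs_nonneg _)) (hdFle y hy κ μ ν) (abs_nonneg _) ?_
        positivity
    _ = η * |γ y κ μ ν| := by ring

/-- A nonnegative site function vanishing on `box p r` and off `box p s` has, over any finite set, sum at most its sum over the shell. [folklore] -/
theorem sum_le_sum_shell_of_nonneg (g : Zd d → ℝ) (p : Zd d) (r s : ℤ) (hg : ∀ y, 0 ≤ g y) (hin : ∀ y ∈ box p r, g y = 0)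
    (hout : ∀ y, y ∉ box p s → g y = 0) (B : Finset (Zd d)) :
    ∑ y ∈ B, g y ≤ ∑ y ∈ box p s \ box p r, g y := by
  have h := sum_abs_le_sum_abs_shell g p r s hin hout B
  have h1 : ∑ y ∈ B, |g y| = ∑ y ∈ B, g y := Finset.sum_congr rfl fun y _ => abs_of_nonneg (hg y)
  have h2 : ∑ y ∈ box p s \ box p r, |g y| = ∑ y ∈ box p s \ box p r, g y := Finset.sum_congr rfl fun y _ => abs_of_nonneg (hg y)
  rwa [h1, h2] at h

/-- Triple-sum pairing estimate: `|Σ_B Σ_μ Σ_ν E·F| ≤ θ·Σ_B Σ_μ Σ_ν |E|` when `|F| ≤ θ` on `B`. [folklore] -/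
theorem abs_sum₃_mul_le (B : Finset (Zd d)) (E F : Zd d → Fin d → Fin d → ℝ) {θ : ℝ} (hF : ∀ y ∈ B, ∀ μ ν, |F y μ ν| ≤ θ) :
    |∑ y ∈ B, ∑ μ, ∑ ν, E y μ ν * F y μ ν| ≤ θ * ∑ y ∈ B, ∑ μ, ∑ ν, |E y μ ν| := by
  refine (Finset.abs_sum_le_sum_abs _ _).trans ?_
  rw [Finset.mul_sum]
  refine Finset.sum_le_sum fun y hy => ?_
  refine (Finset.abs_sum_le_sum_abs _ _).trans ?_
  rw [Finset.mul_sum]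
  refine Finset.sum_le_sum fun μ _ => ?_
  refine (Finset.abs_sum_le_sum_abs _ _).trans ?_
  rw [Finset.mul_sum]
  refine Finset.sum_le_sum fun ν _ => ?_
  rw [abs_mul, mul_comm]
  exact mul_le_mul_of_nonneg_right (hF y hy μ ν) (abs_nonneg _)

/-- **THE DEGREE-2→3 COMMUTATOR ROW**: with `χ = 1` on `box p R`, `= 0` off `box p S`, `|χ(x−e_κ) − χ x| ≤ ρ`, and `|F| ≤ θ` on `Q = box p R′`, `0 ≤ θ`:
`|Σ_Q Σ_{μν} C₂·F| ≤ θ·ρ·Σ_{box p (S+1) ∖ box p (R−1)} Σ_{μν} Σ_κ |γ(y−e_κ,κ,μ,ν)|`. [folklore] -/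
theorem abs_sum_commTwo_mul_le (γ : Zd d → Fin d → Fin d → Fin d → ℝ) (χ : Zd d → ℝ) (p : Zd d) (R S R' : ℤ)
    (hχ1 : ∀ x ∈ box p R, χ x = 1) (hχ0 : ∀ x, x ∉ box p S → χ x = 0) {ρ : ℝ} (hχm : ∀ x μ, |χ (x - unitVec μ) - χ x| ≤ ρ)
    (F : Zd d → Fin d → Fin d → ℝ) {θ : ℝ} (hθ : 0 ≤ θ) (hF : ∀ y ∈ box p R', ∀ μ ν, |F y μ ν| ≤ θ) :
    |∑ y ∈ box p R', ∑ μ, ∑ ν, (∑ κ, (χ y - χ (y - unitVec κ)) * γ (y - unitVec κ) κ μ ν) * F y μ ν|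
      ≤ θ * (ρ * ∑ y ∈ box p (S + 1) \ box p (R - 1), ∑ μ, ∑ ν, ∑ κ, |γ (y - unitVec κ) κ μ ν|) := by
  refine (abs_sum₃_mul_le (box p R') (fun y μ ν => ∑ κ, (χ y - χ (y - unitVec κ)) * γ (y - unitVec κ) κ μ ν) F hF).trans ?_
  refine mul_le_mul_of_nonneg_left ?_ hθ
  -- the commutator lives on the shell
  have hg0 : ∀ y, 0 ≤ ∑ μ, ∑ ν, |∑ κ, (χ y - χ (y - unitVec κ)) * γ (y - unitVec κ) κ μ ν| :=
    fun y => Finset.sum_nonneg fun μ _ => Finset.sum_nonneg fun ν _ => abs_nonneg _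
  have hin : ∀ y ∈ box p (R - 1), ∑ μ, ∑ ν, |∑ κ, (χ y - χ (y - unitVec κ)) * γ (y - unitVec κ) κ μ ν| = 0 := by
    intro y hy
    simp only [deltaThree_comm_eq_zero_of_mem_box hχ1 hy γ, abs_zero, Finset.sum_const_zero]
  have hout : ∀ y, y ∉ box p (S + 1) → ∑ μ, ∑ ν, |∑ κ, (χ y - χ (y - unitVec κ)) * γ (y - unitVec κ) κ μ ν| = 0 := by
    intro y hy
    simp only [deltaThree_comm_eq_zero_of_not_mem_box hχ0 hy γ, abs_zero, Finset.sum_const_zero]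
  refine (sum_le_sum_shell_of_nonneg _ p (R - 1) (S + 1) hg0 hin hout (box p R')).trans ?_
  rw [Finset.mul_sum]
  refine Finset.sum_le_sum fun y _ => ?_
  rw [Finset.mul_sum]
  refine Finset.sum_le_sum fun μ _ => ?_
  rw [Finset.mul_sum]
  refine Finset.sum_le_sum fun ν _ => ?_
  exact abs_deltaThree_comm_le hχm γ y μ ν

/-- **THE DEGREE-1→2 COMMUTATOR ROW**: with `χ = 1` on `box p R`, `= 0` off `box p S`, `|χ(x+e_μ) − χ x| ≤ ρ`, and `|F| ≤ θ` on `Q = box p R′`, `0 ≤ θ`: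
`|Σ_Q Σ_{μν} E₁·F| ≤ θ·ρ·Σ_{box p (S+1) ∖ box p (R−1)} Σ_{μν} (|a(y+e_μ,ν)| + |a(y+e_ν,μ)|)`. [folklore] -/
theorem abs_sum_commOne_mul_le (a : Zd d → Fin d → ℝ) (χ : Zd d → ℝ) (p : Zd d) (R S R' : ℤ)
    (hχ1 : ∀ x ∈ box p R, χ x = 1) (hχ0 : ∀ x, x ∉ box p S → χ x = 0) {ρ : ℝ} (hχp : ∀ x μ, |χ (x + unitVec μ) - χ x| ≤ ρ)
    (F : Zd d → Fin d → Fin d → ℝ) {θ : ℝ} (hθ : 0 ≤ θ) (hF : ∀ y ∈ box p R', ∀ μ ν, |F y μ ν| ≤ θ) :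
    |∑ y ∈ box p R', ∑ μ, ∑ ν,
        ((χ (y + unitVec μ) - χ y) * a (y + unitVec μ) ν - (χ (y + unitVec ν) - χ y) * a (y + unitVec ν) μ) * F y μ ν|
      ≤ θ * (ρ * ∑ y ∈ box p (S + 1) \ box p (R - 1), ∑ μ, ∑ ν, (|a (y + unitVec μ) ν| + |a (y + unitVec ν) μ|)) := by
  refine (abs_sum₃_mul_le (box p R')
    (fun y μ ν => (χ (y + unitVec μ) - χ y) * a (y + unitVec μ) ν - (χ (y + unitVec ν) - χ y) * a (y + unitVec ν) μ) F hF).trans ?_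
  refine mul_le_mul_of_nonneg_left ?_ hθ
  have hg0 : ∀ y, 0 ≤ ∑ μ, ∑ ν, |(χ (y + unitVec μ) - χ y) * a (y + unitVec μ) ν - (χ (y + unitVec ν) - χ y) * a (y + unitVec ν) μ| :=
    fun y => Finset.sum_nonneg fun μ _ => Finset.sum_nonneg fun ν _ => abs_nonneg _
  have hin : ∀ y ∈ box p (R - 1),
      ∑ μ, ∑ ν, |(χ (y + unitVec μ) - χ y) * a (y + unitVec μ) ν - (χ (y + unitVec ν) - χ y) * a (y + unitVec ν) μ| = 0 := by
    intro y hy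
    simp only [curl_comm_eq_zero_of_mem_box hχ1 hy a, abs_zero, Finset.sum_const_zero]
  have hout : ∀ y, y ∉ box p (S + 1) →
      ∑ μ, ∑ ν, |(χ (y + unitVec μ) - χ y) * a (y + unitVec μ) ν - (χ (y + unitVec ν) - χ y) * a (y + unitVec ν) μ| = 0 := by
    intro y hy
    simp only [curl_comm_eq_zero_of_not_mem_box hχ0 hy a, abs_zero, Finset.sum_const_zero]
  refine (sum_le_sum_shell_of_nonneg _ p (R - 1) (S + 1) hg0 hin hout (box p R')).trans ?_
  rw [Finset.mul_sum]
  refine Finset.sum_le_sum fun y _ => ?_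
  rw [Finset.mul_sum]
  refine Finset.sum_le_sum fun μ _ => ?_
  rw [Finset.mul_sum]
  refine Finset.sum_le_sum fun ν _ => ?_
  exact abs_curl_comm_le hχp a y μ ν

/-- ★★★ **THE TRUNCATED PAIRING AGAINST A BOUNDED, ALMOST-CLOSED 2-FORM — THE TWO ERROR ROWS.**  Under the hypotheses of `sum_curl_truncated_mul_eq`, with
`β` antisymmetric, `0 ≤ χ ≤ 1` and `χ` `ρ`-Lipschitz in both directions, `|F| ≤ θ` on `Q = box p R′` (`0 ≤ θ`) and `|d₂F| ≤ η` on `box p S`: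
`|Σ_Q Σ_{μν} d₁a_R·F − Σ_Q Σ_{μν} ω·F| ≤ θ·ρ·SHELL + (η∕3)·BULK`. [folklore] -/
theorem abs_sum_curl_truncated_mul_sub_le (ω β : Zd d → Fin d → Fin d → ℝ) (a : Zd d → Fin d → ℝ) (γ : Zd d → Fin d → Fin d → Fin d → ℝ)
    (χ : Zd d → ℝ) (aR : Zd d → Fin d → ℝ) (daR : Zd d → Fin d → Fin d → ℝ) (p : Zd d) (ℓ R S R' : ℤ)
    (hω0 : ∀ x, x ∉ box p ℓ → ∀ μ ν, ω x μ ν = 0) (hℓR : ℓ ≤ R) (hSR' : S + 2 ≤ R')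
    (hΔ : ∀ x μ ν, ω x μ ν = ∑ κ, (2 * β x μ ν - β (x + unitVec κ) μ ν - β (x - unitVec κ) μ ν))
    (hβanti : ∀ x μ ν, β x ν μ = -β x μ ν)
    (ha : ∀ x ν, a x ν = ∑ μ, (β (x - unitVec μ) μ ν - β x μ ν))
    (hγ : ∀ x κ μ ν, γ x κ μ ν = (β (x + unitVec κ) μ ν - β x μ ν) - (β (x + unitVec μ) κ ν - β x κ ν) + (β (x + unitVec ν) κ μ - β x κ μ))
    (hχ01 : ∀ x, 0 ≤ χ x ∧ χ x ≤ 1) (hχ1 : ∀ x ∈ box p R, χ x = 1) (hχ0 : ∀ x, x ∉ box p S → χ x = 0) {ρ : ℝ}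
    (hχp : ∀ x μ, |χ (x + unitVec μ) - χ x| ≤ ρ) (hχm : ∀ x μ, |χ (x - unitVec μ) - χ x| ≤ ρ)
    (haR : ∀ x ν, aR x ν = χ x * a x ν)
    (hdaR : ∀ x μ ν, daR x μ ν = (aR (x + unitVec μ) ν - aR x ν) - (aR (x + unitVec ν) μ - aR x μ))
    (F : Zd d → Fin d → Fin d → ℝ) (dF : Zd d → Fin d → Fin d → Fin d → ℝ)
    (hdF : ∀ x κ μ ν, dF x κ μ ν = (F (x + unitVec κ) μ ν - F x μ ν) - (F (x + unitVec μ) κ ν - F x κ ν) + (F (x + unitVec ν) κ μ - F x κ μ))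
    {θ η : ℝ} (hθ : 0 ≤ θ) (hF : ∀ y ∈ box p R', ∀ μ ν, |F y μ ν| ≤ θ) (hdFle : ∀ y ∈ box p S, ∀ κ μ ν, |dF y κ μ ν| ≤ η) :
    |∑ y ∈ box p R', ∑ μ, ∑ ν, daR y μ ν * F y μ ν - ∑ y ∈ box p R', ∑ μ, ∑ ν, ω y μ ν * F y μ ν|
      ≤ θ * (ρ * ∑ y ∈ box p (S + 1) \ box p (R - 1), ∑ μ, ∑ ν,
              (|a (y + unitVec μ) ν| + |a (y + unitVec ν) μ| + ∑ κ, |γ (y - unitVec κ) κ μ ν|))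
        + η / 3 * ∑ y ∈ box p S, ∑ κ, ∑ μ, ∑ ν, |γ y κ μ ν| := by
  rw [sum_curl_truncated_mul_eq ω β a γ χ aR daR p ℓ R S R' hω0 hℓR hSR' hΔ ha hγ hχ1 hχ0 haR hdaR F]
  have hB := abs_bulk_le β γ χ p S R' hγ hβanti hχ01 hχ0 (by linarith) F dF hdF hdFle
  have hC := abs_sum_commTwo_mul_le γ χ p R S R' hχ1 hχ0 hχm F hθ hF
  have hE := abs_sum_commOne_mul_le a χ p R S R' hχ1 hχ0 hχp F hθ hF
  -- combine the shell rows
  have hshell : θ * (ρ * ∑ y ∈ box p (S + 1) \ box p (R - 1), ∑ μ, ∑ ν,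
        (|a (y + unitVec μ) ν| + |a (y + unitVec ν) μ| + ∑ κ, |γ (y - unitVec κ) κ μ ν|))
      = θ * (ρ * ∑ y ∈ box p (S + 1) \ box p (R - 1), ∑ μ, ∑ ν, (|a (y + unitVec μ) ν| + |a (y + unitVec ν) μ|))
        + θ * (ρ * ∑ y ∈ box p (S + 1) \ box p (R - 1), ∑ μ, ∑ ν, ∑ κ, |γ (y - unitVec κ) κ μ ν|) := by
    simp only [Finset.sum_add_distrib]; ring
  rw [hshell]
  rw [abs_le] at hB hC hE ⊢
  constructor <;> linarith [hB.1, hB.2, hC.1, hC.2, hE.1, hE.2]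

/-! ## §4 ℓ² preparation -/

/-- ℓ² PREP, pointwise: `(d₁a_R)² ≤ 2·(d₁a)² + 2·E₁²` where `d₁a = ω − δ₃γ` and `0 ≤ χ ≤ 1`. [folklore] -/
theorem sq_curl_truncated_le (ω β : Zd d → Fin d → Fin d → ℝ) (a : Zd d → Fin d → ℝ) (γ : Zd d → Fin d → Fin d → Fin d → ℝ) (χ : Zd d → ℝ)
    (aR : Zd d → Fin d → ℝ) (daR : Zd d → Fin d → Fin d → ℝ)
    (hΔ : ∀ x μ ν, ω x μ ν = ∑ κ, (2 * β x μ ν - β (x + unitVec κ) μ ν - β (x - unitVec κ) μ ν))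
    (ha : ∀ x ν, a x ν = ∑ μ, (β (x - unitVec μ) μ ν - β x μ ν))
    (hγ : ∀ x κ μ ν, γ x κ μ ν = (β (x + unitVec κ) μ ν - β x μ ν) - (β (x + unitVec μ) κ ν - β x κ ν) + (β (x + unitVec ν) κ μ - β x κ μ))
    (hχ01 : ∀ x, 0 ≤ χ x ∧ χ x ≤ 1) (haR : ∀ x ν, aR x ν = χ x * a x ν)
    (hdaR : ∀ x μ ν, daR x μ ν = (aR (x + unitVec μ) ν - aR x ν) - (aR (x + unitVec ν) μ - aR x μ)) (x : Zd d) (μ ν : Fin d) :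
    daR x μ ν ^ 2 ≤ 2 * (ω x μ ν - ∑ κ, (γ (x - unitVec κ) κ μ ν - γ x κ μ ν)) ^ 2
      + 2 * ((χ (x + unitVec μ) - χ x) * a (x + unitVec μ) ν - (χ (x + unitVec ν) - χ x) * a (x + unitVec ν) μ) ^ 2 := by
  have h1 := curl_mul_eq_of_letter χ a (fun y μ' ν' => (a (y + unitVec μ') ν' - a y ν') - (a (y + unitVec ν') μ' - a y μ'))
    (fun _ _ _ => rfl) x μ ν
  have h2 := curl_deltaTwo_eq β a γ ω ha hγ x μ ν (hΔ x μ ν)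
  rw [hdaR, haR, haR, haR, haR, h1, h2]
  set D := ω x μ ν - ∑ κ, (γ (x - unitVec κ) κ μ ν - γ x κ μ ν)
  set E := (χ (x + unitVec μ) - χ x) * a (x + unitVec μ) ν - (χ (x + unitVec ν) - χ x) * a (x + unitVec ν) μ
  have hχ2 : χ x ^ 2 ≤ 1 := by
    have := hχ01 x; nlinarith
  have hD : (χ x * D) ^ 2 ≤ D ^ 2 := by
    rw [mul_pow]; nlinarith [sq_nonneg D]
  calc (χ x * D + E) ^ 2 ≤ 2 * (χ x * D) ^ 2 + 2 * E ^ 2 := by nlinarith [sq_nonneg (χ x * D - E)]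
    _ ≤ 2 * D ^ 2 + 2 * E ^ 2 := by linarith

/-- The squared degree-1→2 commutator: `E₁² ≤ 2ρ²·(a(x+e_μ,ν)² + a(x+e_ν,μ)²)` for a `ρ`-Lipschitz cutoff. [folklore] -/
theorem sq_commOne_le (a : Zd d → Fin d → ℝ) (χ : Zd d → ℝ) {ρ : ℝ} (hχp : ∀ x μ, |χ (x + unitVec μ) - χ x| ≤ ρ) (x : Zd d) (μ ν : Fin d) :
    ((χ (x + unitVec μ) - χ x) * a (x + unitVec μ) ν - (χ (x + unitVec ν) - χ x) * a (x + unitVec ν) μ) ^ 2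
      ≤ 2 * ρ ^ 2 * (a (x + unitVec μ) ν ^ 2 + a (x + unitVec ν) μ ^ 2) := by
  have hμ : (χ (x + unitVec μ) - χ x) ^ 2 ≤ ρ ^ 2 := by
    have := hχp x μ; rw [← sq_abs]; exact pow_le_pow_left₀ (abs_nonneg _) this 2
  have hν : (χ (x + unitVec ν) - χ x) ^ 2 ≤ ρ ^ 2 := by
    have := hχp x ν; rw [← sq_abs]; exact pow_le_pow_left₀ (abs_nonneg _) this 2
  calc ((χ (x + unitVec μ) - χ x) * a (x + unitVec μ) ν - (χ (x + unitVec ν) - χ x) * a (x + unitVec ν) μ) ^ 2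
      ≤ 2 * ((χ (x + unitVec μ) - χ x) * a (x + unitVec μ) ν) ^ 2 + 2 * ((χ (x + unitVec ν) - χ x) * a (x + unitVec ν) μ) ^ 2 := by
        nlinarith [sq_nonneg ((χ (x + unitVec μ) - χ x) * a (x + unitVec μ) ν + (χ (x + unitVec ν) - χ x) * a (x + unitVec ν) μ)]
    _ = 2 * ((χ (x + unitVec μ) - χ x) ^ 2 * a (x + unitVec μ) ν ^ 2) + 2 * ((χ (x + unitVec ν) - χ x) ^ 2 * a (x + unitVec ν) μ ^ 2) := by ring
    _ ≤ 2 * (ρ ^ 2 * a (x + unitVec μ) ν ^ 2) + 2 * (ρ ^ 2 * a (x + unitVec ν) μ ^ 2) := by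
        gcongr
    _ = 2 * ρ ^ 2 * (a (x + unitVec μ) ν ^ 2 + a (x + unitVec ν) μ ^ 2) := by ring

/-- ℓ² PREP, summed over any finite set of sites: `Σ_B Σ_{μν} (d₁a_R)² ≤ 2·Σ_B Σ_{μν} (ω − δ₃γ)² + 4ρ²·Σ_B Σ_{μν} (a(y+e_μ,ν)² + a(y+e_ν,μ)²)`. [folklore] -/
theorem sum_sq_curl_truncated_le (ω β : Zd d → Fin d → Fin d → ℝ) (a : Zd d → Fin d → ℝ) (γ : Zd d → Fin d → Fin d → Fin d → ℝ) (χ : Zd d → ℝ)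
    (aR : Zd d → Fin d → ℝ) (daR : Zd d → Fin d → Fin d → ℝ)
    (hΔ : ∀ x μ ν, ω x μ ν = ∑ κ, (2 * β x μ ν - β (x + unitVec κ) μ ν - β (x - unitVec κ) μ ν))
    (ha : ∀ x ν, a x ν = ∑ μ, (β (x - unitVec μ) μ ν - β x μ ν))
    (hγ : ∀ x κ μ ν, γ x κ μ ν = (β (x + unitVec κ) μ ν - β x μ ν) - (β (x + unitVec μ) κ ν - β x κ ν) + (β (x + unitVec ν) κ μ - β x κ μ))
    (hχ01 : ∀ x, 0 ≤ χ x ∧ χ x ≤ 1) {ρ : ℝ} (hχp : ∀ x μ, |χ (x + unitVec μ) - χ x| ≤ ρ) (haR : ∀ x ν, aR x ν = χ x * a x ν)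
    (hdaR : ∀ x μ ν, daR x μ ν = (aR (x + unitVec μ) ν - aR x ν) - (aR (x + unitVec ν) μ - aR x μ)) (B : Finset (Zd d)) :
    ∑ y ∈ B, ∑ μ, ∑ ν, daR y μ ν ^ 2
      ≤ 2 * ∑ y ∈ B, ∑ μ, ∑ ν, (ω y μ ν - ∑ κ, (γ (y - unitVec κ) κ μ ν - γ y κ μ ν)) ^ 2
        + 4 * ρ ^ 2 * ∑ y ∈ B, ∑ μ, ∑ ν, (a (y + unitVec μ) ν ^ 2 + a (y + unitVec ν) μ ^ 2) := by
  have hpt : ∀ y μ ν, daR y μ ν ^ 2 ≤ 2 * (ω y μ ν - ∑ κ, (γ (y - unitVec κ) κ μ ν - γ y κ μ ν)) ^ 2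
      + 4 * ρ ^ 2 * (a (y + unitVec μ) ν ^ 2 + a (y + unitVec ν) μ ^ 2) := by
    intro y μ ν
    have h1 := sq_curl_truncated_le ω β a γ χ aR daR hΔ ha hγ hχ01 haR hdaR y μ ν
    have h2 := sq_commOne_le a χ hχp y μ ν
    linarith
  calc ∑ y ∈ B, ∑ μ, ∑ ν, daR y μ ν ^ 2
      ≤ ∑ y ∈ B, ∑ μ, ∑ ν, (2 * (ω y μ ν - ∑ κ, (γ (y - unitVec κ) κ μ ν - γ y κ μ ν)) ^ 2
          + 4 * ρ ^ 2 * (a (y + unitVec μ) ν ^ 2 + a (y + unitVec ν) μ ^ 2)) :=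
        Finset.sum_le_sum fun y _ => Finset.sum_le_sum fun μ _ => Finset.sum_le_sum fun ν _ => hpt y μ ν
    _ = _ := by simp only [Finset.sum_add_distrib, Finset.mul_sum, mul_add]

/-! ## §5 ℓ¹ ∕ sup preparation -/

/-- `|a_R(x,ν)| ≤ |a(x,ν)|` for `0 ≤ χ ≤ 1`. [folklore] -/
theorem abs_truncated_le (a : Zd d → Fin d → ℝ) (χ : Zd d → ℝ) (aR : Zd d → Fin d → ℝ) (hχ01 : ∀ x, 0 ≤ χ x ∧ χ x ≤ 1)
    (haR : ∀ x ν, aR x ν = χ x * a x ν) (x : Zd d) (ν : Fin d) : |aR x ν| ≤ |a x ν| := by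
  rw [haR, abs_mul, abs_of_nonneg (hχ01 x).1]
  calc χ x * |a x ν| ≤ 1 * |a x ν| := mul_le_mul_of_nonneg_right (hχ01 x).2 (abs_nonneg _)
    _ = |a x ν| := one_mul _

/-- `a_R` vanishes off `box p S`. [folklore] -/
theorem truncated_eq_zero_off (a : Zd d → Fin d → ℝ) (χ : Zd d → ℝ) (aR : Zd d → Fin d → ℝ) {p : Zd d} {S : ℤ}
    (hχ0 : ∀ x, x ∉ box p S → χ x = 0) (haR : ∀ x ν, aR x ν = χ x * a x ν) (x : Zd d) (hx : x ∉ box p S) (ν : Fin d) : aR x ν = 0 := by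
  rw [haR, hχ0 x hx, zero_mul]

/-- ℓ¹ PREP: over any finite set `B`, `Σ_B Σ_ν |a_R| ≤ Σ_{box p S} Σ_ν |a|`. [folklore] -/
theorem sum_abs_truncated_le (a : Zd d → Fin d → ℝ) (χ : Zd d → ℝ) (aR : Zd d → Fin d → ℝ) (p : Zd d) (S : ℤ)
    (hχ01 : ∀ x, 0 ≤ χ x ∧ χ x ≤ 1) (hχ0 : ∀ x, x ∉ box p S → χ x = 0) (haR : ∀ x ν, aR x ν = χ x * a x ν) (B : Finset (Zd d)) :
    ∑ y ∈ B, ∑ ν, |aR y ν| ≤ ∑ y ∈ box p S, ∑ ν, |a y ν| := by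
  classical
  have h1 : ∑ y ∈ B, ∑ ν, |aR y ν| = ∑ y ∈ B ∩ box p S, ∑ ν, |aR y ν| := by
    refine (Finset.sum_subset Finset.inter_subset_left fun y hyB hy => ?_).symm
    rw [Finset.mem_inter, not_and] at hy
    simp only [truncated_eq_zero_off a χ aR hχ0 haR y (hy hyB), abs_zero, Finset.sum_const_zero]
  rw [h1]
  calc ∑ y ∈ B ∩ box p S, ∑ ν, |aR y ν| ≤ ∑ y ∈ B ∩ box p S, ∑ ν, |a y ν| :=
        Finset.sum_le_sum fun y _ => Finset.sum_le_sum fun ν _ => abs_truncated_le a χ aR hχ01 haR y ν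
    _ ≤ ∑ y ∈ box p S, ∑ ν, |a y ν| :=
        Finset.sum_le_sum_of_subset_of_nonneg Finset.inter_subset_right fun y _ _ => Finset.sum_nonneg fun ν _ => abs_nonneg _

end Summit.QuantumFields.YangMills.Theorems.CovariantDischargeTruncatedPotentialPairing

end
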